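import Summits.QuantumFields.GaugeBoot.TiltedBoxOddAxisSlab
import HarnessLib

/-!
# The slab above a layer of the square tilted box: slab plaquettes as weights on the layer above (gauge-boot, L3 negative supplement; twisted-slab mechanism, box bookkeeping for every side and layer)

HONEST FRAMING (cell `pub-gaugeboot`, page 1 of every file): the venture produces certified bounds
on lattice expectations at stated coupling, gauge group, dimension and torus size; NOT a mass gap,
NOT a continuum limit, NOT a string tension; NOT Yang–Mills-summit-bearing (barriers
`FixedCouplingUltralocality`, `PerturbativeInvisibility`). Bookkeeping for the NEGATIVE result
`TiltedBoxEvenMidAxisRPNegative.lean` (and a uniform restatement of `TiltedBoxOddAxisSlab.lean`).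

`TiltedBoxOddAxisSlab.lean` reads the slab of the ODD square box `ℤ^d/Γ(2P+1, 2P+1, L)` between the
layers `x_i ≡ P` and `x_i ≡ P + 1` through the links of the layer above. Nothing in that bookkeeping
uses the parity of the side or the value of the layer, and the even-side mid-plane negative needs the
same slab between the layers `P` and `P + 1` of `ℤ^d/Γ(2P, 2P, L)`. This file is the uniform version:
square box `ℤ^d/Γ(M, M, L)` of ANY side `M` (coordinate `x_i mod M`, `axisCoord`), ANY layer
`a ∈ ℤ/M`. The SLAB above `a` consists of the plaquettes with an `i`-side based in the layer
`x_i ≡ a` (`SquareSlab.IsSlabPlaq a`); each is read through the link of the layer `a + 1` above it: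
the slab plaquette `(y; i, m)` has holonomy `C₁ B C₂⁻¹ A⁻¹` with `A = U(y, m)` (layer `a`),
`B = U(y + e_i, m)` (layer `a + 1`), `C₁ = U(y, i)`, `C₂ = U(y + e_m, i)` (crossing links), so its
Boltzmann factor is `w_β(a_t B⁻¹ b_t)` with `t = (y + e_i, m)`, `a_t = A C₂`, `b_t = C₁⁻¹`
(`SquareSlab.frozenA`, `SquareSlab.frozenB`, guarded by membership in the block) — the shape of
`TwistedSlab.slab_integral_frozen`:

* `SquareSlab.block … a` — the links `(y', m)`, `x_i(y') = a + 1`, `m ≠ i`; the bijection slab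
  plaquettes ↔ block links and **`SquareSlab.prod_exp_slab_eq`**:
  `∏_{p slab} exp(β Re tr ρ(U_p)) = ∏_{t ∈ block} w_β(a_t(U) U_t⁻¹ b_t(U))`;
* `frozenA`/`frozenB` are continuous and depend only on links OFF the block (`M ≥ 2`), as does the
  observable of a transverse plaquette inside the layer `a` (`dependsOn_plaqObs_layer`);
* for a transverse plaquette `(y + e_i; a', b')` of the layer `a + 1`: its links lie in the block and
  **`SquareSlab.re_trace_slabWord`**: the word `b₀a₀b₁a₁a₂⁻¹b₂⁻¹a₃⁻¹b₃⁻¹` of `slab_integral` is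
  `U(y,i)⁻¹ · U_{(y; a', b')} · U(y,i)`, so its `Re tr ρ` is the observable of the plaquette
  `(y; a', b')` BELOW — the slab transfers plaquette observables one layer down.

The slab step itself (the integral identity) is `TiltedBoxSquareSlabStep.lean`. Everything is
`[folklore]` bookkeeping.

References: K. Osterwalder, E. Seiler, Ann. Phys. 110 (1978) 440, §2; J. Fröhlich, R. Israel,
E. H. Lieb, B. Simon, J. Stat. Phys. 22 (1980) 297, §3.
-/

noncomputable section

open QuotientAddGroup
open Literature.RepresentationTheory.CompactGroups

namespace Summit.QuantumFields.GaugeBoot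

namespace TiltedRP

namespace SquareSlab

section Slab

variable {d : ℕ} {i j : Fin d} {L M : ℕ}

/-! ## Slab plaquettes, the block above a layer and the frozen neighbours -/

/-- **A slab plaquette above the layer `a`**: an `i`-side, based in the layer `x_i ≡ a` (so it
connects the layer `a` to the layer `a + 1`). [folklore] -/
def IsSlabPlaq (a : ZMod M) (p : Plaq (TiltedSite d i j M M L) d) : Prop :=
  (p.2.1.1 = i ∨ p.2.1.2 = i) ∧ axisCoord d L M p.1 = a

/-- `IsSlabPlaq` is decidable. [folklore] -/
instance (a : ZMod M) (p : Plaq (TiltedSite d i j M M L) d) : Decidable (IsSlabPlaq a p) := by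
  unfold IsSlabPlaq; infer_instance

/-- **A block link above the layer `a`**: a link `(y', m)` of the layer `x_i(y') = a + 1` with
`m ≠ i`. [folklore] -/
def IsBlockLink (a : ZMod M) (t : Link (TiltedSite d i j M M L) d) : Prop :=
  axisCoord d L M t.1 = a + 1 ∧ t.2 ≠ i

/-- `IsBlockLink` is decidable. [folklore] -/
instance (a : ZMod M) (t : Link (TiltedSite d i j M M L) d) : Decidable (IsBlockLink a t) := by
  unfold IsBlockLink; infer_instance

variable [NeZero M] [NeZero L]

variable (d i j L M) in
/-- **The block**: the finite set of block links above the layer `a`. [folklore] -/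
def block (a : ZMod M) : Finset (Link (TiltedSite d i j M M L) d) :=
  Finset.univ.filter (IsBlockLink a)

/-- Membership in the block. [folklore] -/
theorem mem_block {a : ZMod M} {t : Link (TiltedSite d i j M M L) d} :
    t ∈ block d i j L M a ↔ axisCoord d L M t.1 = a + 1 ∧ t.2 ≠ i := by
  simp [block, IsBlockLink]

/-- Membership in the block is the block predicate. [folklore] -/
theorem isBlockLink_iff {a : ZMod M} {t : Link (TiltedSite d i j M M L) d} :
    IsBlockLink a t ↔ t ∈ block d i j L M a := by
  simp [block]

variable {G : Type*} [Group G] [DecidableEq (TiltedSite d i j M M L)]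

/-- The frozen neighbour `a_t = U(y, m) U(y + e_m, i)` of the block link `t = (y + e_i, m)` (and `1`
off the block). [folklore] -/
def frozenA (a : ZMod M) (t : Link (TiltedSite d i j M M L) d) (U : Config (TiltedSite d i j M M L) d G) : G :=
  if IsBlockLink a t then
    U (t.1 - tiltedUnit d i j M M L i, t.2) * U (t.1 - tiltedUnit d i j M M L i + tiltedUnit d i j M M L t.2, i)
  else 1

/-- The frozen neighbour `b_t = U(y, i)⁻¹` of the block link `t = (y + e_i, m)` (and `1` off the
block). [folklore] -/
def frozenB (a : ZMod M) (t : Link (TiltedSite d i j M M L) d) (U : Config (TiltedSite d i j M M L) d G) : G :=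
  if IsBlockLink a t then (U (t.1 - tiltedUnit d i j M M L i, i))⁻¹ else 1

omit [DecidableEq (TiltedSite d i j M M L)] in
/-- A link of direction `i` is not in the block. [folklore] -/
theorem not_mem_block_of_dir (a : ZMod M) (x : TiltedSite d i j M M L) : (x, i) ∉ block d i j L M a :=
  fun h => (mem_block.1 h).2 rfl

omit [DecidableEq (TiltedSite d i j M M L)] in
/-- A link based in the layer `a` is not in the block above `a` (`M ≥ 2`). [folklore] -/
theorem not_mem_block_of_layer [Fact (1 < M)] {a : ZMod M} {x : TiltedSite d i j M M L}
    (hx : axisCoord d L M x = a) (m : Fin d) : (x, m) ∉ block d i j L M a := by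
  intro h
  have h1 := (mem_block.1 h).1
  rw [hx] at h1
  have h2 : (1 : ZMod M) = 0 := by
    have := congrArg (fun z => z - a) h1
    simpa using this.symm
  exact one_ne_zero h2

omit [DecidableEq (TiltedSite d i j M M L)] in
/-- The base point below a block link lies in the layer `a`. [folklore] -/
theorem axisCoord_sub_of_mem_block {a : ZMod M} {t : Link (TiltedSite d i j M M L) d}
    (ht : t ∈ block d i j L M a) :
    axisCoord d L M (t.1 - tiltedUnit d i j M M L i) = a := by
  rw [map_sub, (mem_block.1 ht).1, axisCoord_tiltedUnit_self, add_sub_cancel_right]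

/-- `a_t` depends only on links off the block. [folklore] -/
theorem dependsOn_frozenA [Fact (1 < M)] (a : ZMod M) (t : Link (TiltedSite d i j M M L) d) :
    DependsOn (frozenA (G := G) a t) (((block d i j L M a)ᶜ : Finset _) : Set _) := by
  intro U V hUV
  unfold frozenA
  by_cases ht : IsBlockLink a t
  · have ht' : t ∈ block d i j L M a := isBlockLink_iff.1 ht
    rw [if_pos ht, if_pos ht,
      hUV _ (by simpa using not_mem_block_of_layer (axisCoord_sub_of_mem_block ht') t.2),
      hUV _ (by simpa using not_mem_block_of_dir a _)]
  · rw [if_neg ht, if_neg ht]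

/-- `b_t` depends only on links off the block. [folklore] -/
theorem dependsOn_frozenB (a : ZMod M) (t : Link (TiltedSite d i j M M L) d) :
    DependsOn (frozenB (G := G) a t) (((block d i j L M a)ᶜ : Finset _) : Set _) := by
  intro U V hUV
  unfold frozenB
  by_cases ht : IsBlockLink a t
  · rw [if_pos ht, if_pos ht, hUV _ (by simpa using not_mem_block_of_dir a _)]
  · rw [if_neg ht, if_neg ht]

/-- The observable of a transverse plaquette inside the layer `a` depends only on links off the
block. [folklore] -/
theorem dependsOn_plaqObs_layer [Fact (1 < M)] {N : ℕ} (ρ : G →* Matrix (Fin N) (Fin N) ℂ) {a : ZMod M}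
    (p : Plaq (TiltedSite d i j M M L) d) (hp : axisCoord d L M p.1 = a) (ha : p.2.1.1 ≠ i) (hb : p.2.1.2 ≠ i) :
    DependsOn (fun U : Config (TiltedSite d i j M M L) d G => plaqObs ρ (tiltedUnit d i j M M L) p U)
      (((block d i j L M a)ᶜ : Finset _) : Set _) := by
  intro U V hUV
  have h1 : axisCoord d L M (p.1 + tiltedUnit d i j M M L p.2.1.1) = a := by
    rw [axisCoord_add_tiltedUnit, if_neg ha, add_zero, hp]
  have h2 : axisCoord d L M (p.1 + tiltedUnit d i j M M L p.2.1.2) = a := by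
    rw [axisCoord_add_tiltedUnit, if_neg hb, add_zero, hp]
  dsimp only
  unfold plaqObs
  rw [holonomy_congr _ p.1 p.2.1.1 p.2.1.2
    (hUV _ (by simpa using not_mem_block_of_layer hp _))
    (hUV _ (by simpa using not_mem_block_of_layer h1 _))
    (hUV _ (by simpa using not_mem_block_of_layer h2 _))
    (hUV _ (by simpa using not_mem_block_of_layer hp _))]

section Continuity

variable [TopologicalSpace G] [IsTopologicalGroup G]

omit [NeZero M] [NeZero L] [DecidableEq (TiltedSite d i j M M L)] in
/-- `a_t` is continuous. [folklore] -/
theorem continuous_frozenA (a : ZMod M) (t : Link (TiltedSite d i j M M L) d) :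
    Continuous (frozenA (G := G) (L := L) a t) := by
  unfold frozenA
  by_cases ht : IsBlockLink a t
  · simp only [if_pos ht]
    exact (continuous_apply _).mul (continuous_apply _)
  · simp only [if_neg ht]
    exact continuous_const

omit [NeZero M] [NeZero L] [DecidableEq (TiltedSite d i j M M L)] in
/-- `b_t` is continuous. [folklore] -/
theorem continuous_frozenB (a : ZMod M) (t : Link (TiltedSite d i j M M L) d) :
    Continuous (frozenB (G := G) (L := L) a t) := by
  unfold frozenB
  by_cases ht : IsBlockLink a t
  · simp only [if_pos ht]
    exact (continuous_apply _).inv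
  · simp only [if_neg ht]
    exact continuous_const

end Continuity

/-! ## The slab plaquettes are the weights of the block -/

variable {N : ℕ} [TopologicalSpace G] [IsTopologicalGroup G] [CompactSpace G]
  (ρ : G →* Matrix (Fin N) (Fin N) ℂ)

omit [NeZero M] [NeZero L] [DecidableEq (TiltedSite d i j M M L)] in
/-- The Boltzmann factor of one slab plaquette is the weight of the block link above it. [folklore] -/
theorem exp_plaqObs_slab_eq (hρ : Continuous ρ) (β : ℝ) {a : ZMod M}
    (U : Config (TiltedSite d i j M M L) d G)
    {p : Plaq (TiltedSite d i j M M L) d} (hdir : p.2.1.1 = i ∨ p.2.1.2 = i)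
    (hlay : axisCoord d L M p.1 = a) :
    Real.exp (β * plaqObs ρ (tiltedUnit d i j M M L) p U) =
      TwistedSlab.wilsonWeight ρ β
        (frozenA a (p.1 + tiltedUnit d i j M M L i, otherDir i p) U *
          (U (p.1 + tiltedUnit d i j M M L i, otherDir i p))⁻¹ *
          frozenB a (p.1 + tiltedUnit d i j M M L i, otherDir i p) U) := by
  have ht : IsBlockLink a (p.1 + tiltedUnit d i j M M L i, otherDir i p) := by
    refine ⟨?_, otherDir_ne hdir⟩
    show axisCoord d L M (p.1 + tiltedUnit d i j M M L i) = _
    rw [axisCoord_add_tiltedUnit, if_pos rfl, hlay]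
  rw [IsSiteFrame.plaqObs_of_hasDir ρ hρ hdir, TwistedSlab.wilsonWeight,
    ← CompactGroup.re_trace_map_inv ρ hρ]
  have hX : (holonomy (tiltedUnit d i j M M L) U p.1 i (otherDir i p))⁻¹ =
      frozenA a (p.1 + tiltedUnit d i j M M L i, otherDir i p) U *
        (U (p.1 + tiltedUnit d i j M M L i, otherDir i p))⁻¹ *
        frozenB a (p.1 + tiltedUnit d i j M M L i, otherDir i p) U := by
    simp only [frozenA, frozenB, if_pos ht, holonomy, add_sub_cancel_right]
    group
  rw [hX]

omit [DecidableEq (TiltedSite d i j M M L)] in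
open scoped Classical in
/-- **The Boltzmann factor of the slab above the layer `a`, read on the block**:
`∏_{p slab} exp(β Re tr ρ(U_p)) = ∏_{t ∈ block} w_β(a_t(U) U_t⁻¹ b_t(U))`. [folklore] -/
theorem prod_exp_slab_eq (hρ : Continuous ρ) (β : ℝ) (a : ZMod M)
    (U : Config (TiltedSite d i j M M L) d G) :
    ∏ p ∈ Finset.univ.filter (IsSlabPlaq a),
        Real.exp (β * plaqObs ρ (tiltedUnit d i j M M L) p U) =
      ∏ t ∈ block d i j L M a, TwistedSlab.wilsonWeight ρ β (frozenA a t U * (U t)⁻¹ * frozenB a t U) := by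
  refine Finset.prod_bij'
    (fun p _ => (p.1 + tiltedUnit d i j M M L i, otherDir i p))
    (fun t ht => (t.1 - tiltedUnit d i j M M L i, mkDirPair i t.2 (mem_block.1 ht).2))
    (fun p hp => ?_) (fun t ht => ?_) (fun p hp => ?_) (fun t ht => ?_) (fun p hp => ?_)
  · -- into the block
    rw [Finset.mem_filter] at hp
    obtain ⟨-, hdir, hlay⟩ := hp
    rw [mem_block]
    refine ⟨?_, otherDir_ne hdir⟩
    show axisCoord d L M (p.1 + tiltedUnit d i j M M L i) = _
    rw [axisCoord_add_tiltedUnit, if_pos rfl, hlay]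
  · -- back to the slab
    rw [Finset.mem_filter]
    exact ⟨Finset.mem_univ _, mkDirPair_hasDir i t.2 (mem_block.1 ht).2, axisCoord_sub_of_mem_block ht⟩
  · -- left inverse
    rw [Finset.mem_filter] at hp
    obtain ⟨-, hdir, -⟩ := hp
    ext1
    · exact add_sub_cancel_right _ _
    · exact mkDirPair_otherDir p hdir
  · -- right inverse
    ext1
    · exact sub_add_cancel _ _
    · exact otherDir_mkDirPair _ i t.2 (mem_block.1 ht).2
  · -- the value
    rw [Finset.mem_filter] at hp
    obtain ⟨-, hdir, hlay⟩ := hp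
    exact exp_plaqObs_slab_eq ρ hρ β U hdir hlay

/-! ## A transverse plaquette of the layer above the slab -/

section Above

variable {a : ZMod M} (y : TiltedSite d i j M M L) {a' b' : Fin d} (ha : a' ≠ i) (hb : b' ≠ i)
  (hy : axisCoord d L M y = a)
include ha hb hy

omit [Group G] [TopologicalSpace G] [IsTopologicalGroup G] [CompactSpace G]
  [DecidableEq (TiltedSite d i j M M L)] ha hb in
/-- The links of the plaquette `(y + e_i; a', b')` lie in the block. [folklore] -/
theorem mem_block_above (c : Fin d) (hc : c ≠ i) (v : TiltedSite d i j M M L) (hv : axisCoord d L M v = 0) :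
    (y + tiltedUnit d i j M M L i + v, c) ∈ block d i j L M a := by
  rw [mem_block]
  refine ⟨?_, hc⟩
  show axisCoord d L M (y + tiltedUnit d i j M M L i + v) = _
  rw [map_add, axisCoord_add_tiltedUnit, if_pos rfl, hy, hv, add_zero]

omit [TopologicalSpace G] [IsTopologicalGroup G] [CompactSpace G] [DecidableEq (TiltedSite d i j M M L)] in
/-- **The slab word is the conjugated holonomy of the plaquette below**:
`Re tr ρ(b₀a₀b₁a₁a₂⁻¹b₂⁻¹a₃⁻¹b₃⁻¹) = Re tr ρ(U_{(y; a', b')})` for the four block links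
`t₀ = (y+e_i, a')`, `t₁ = (y+e_i+e_{a'}, b')`, `t₂ = (y+e_i+e_{b'}, a')`, `t₃ = (y+e_i, b')` of the
plaquette `(y + e_i; a', b')`. [folklore] -/
theorem re_trace_slabWord (U : Config (TiltedSite d i j M M L) d G) :
    ((ρ (frozenB a (y + tiltedUnit d i j M M L i, a') U *
        frozenA a (y + tiltedUnit d i j M M L i, a') U *
        frozenB a (y + tiltedUnit d i j M M L i + tiltedUnit d i j M M L a', b') U *
        frozenA a (y + tiltedUnit d i j M M L i + tiltedUnit d i j M M L a', b') U *
        (frozenA a (y + tiltedUnit d i j M M L i + tiltedUnit d i j M M L b', a') U)⁻¹ *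
        (frozenB a (y + tiltedUnit d i j M M L i + tiltedUnit d i j M M L b', a') U)⁻¹ *
        (frozenA a (y + tiltedUnit d i j M M L i, b') U)⁻¹ *
        (frozenB a (y + tiltedUnit d i j M M L i, b') U)⁻¹)).trace).re =
      ((ρ (holonomy (tiltedUnit d i j M M L) U y a' b')).trace).re := by
  have h0 : IsBlockLink a (y + tiltedUnit d i j M M L i, a') :=
    isBlockLink_iff.2 (by simpa using mem_block_above y hy a' ha 0 (map_zero _))
  have h3 : IsBlockLink a (y + tiltedUnit d i j M M L i, b') :=
    isBlockLink_iff.2 (by simpa using mem_block_above y hy b' hb 0 (map_zero _))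
  have h1 : IsBlockLink a (y + tiltedUnit d i j M M L i + tiltedUnit d i j M M L a', b') :=
    isBlockLink_iff.2 (mem_block_above y hy b' hb _ (axisCoord_tiltedUnit_of_ne d L _ ha))
  have h2 : IsBlockLink a (y + tiltedUnit d i j M M L i + tiltedUnit d i j M M L b', a') :=
    isBlockLink_iff.2 (mem_block_above y hy a' ha _ (axisCoord_tiltedUnit_of_ne d L _ hb))
  have e1 : y + tiltedUnit d i j M M L i + tiltedUnit d i j M M L a' - tiltedUnit d i j M M L i =
      y + tiltedUnit d i j M M L a' := by abel
  have e2 : y + tiltedUnit d i j M M L i + tiltedUnit d i j M M L b' - tiltedUnit d i j M M L i =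
      y + tiltedUnit d i j M M L b' := by abel
  have e3 : y + tiltedUnit d i j M M L b' + tiltedUnit d i j M M L a' =
      y + tiltedUnit d i j M M L a' + tiltedUnit d i j M M L b' := by abel
  rw [← congrArg Complex.re (CompactGroup.trace_conj_eq ρ
    (holonomy (tiltedUnit d i j M M L) U y a' b') (U (y, i))⁻¹)]
  congr 3
  simp only [frozenA, frozenB, if_pos h0, if_pos h1, if_pos h2, if_pos h3, add_sub_cancel_right, e1, e2,
    e3, holonomy]
  group

end Above

end Slab

end SquareSlab

end TiltedRP

end Summit.QuantumFields.GaugeBoot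

end
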